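import Summits.AnomalousDissipation.AnomalousDissipation.Theorems.NeutralTaylorWavesTaylorWaveQuasiSteadyStubFormalExpansionW
import Literature.Analysis.FunctionSpaces.TorusCalculusProofs
import Literature.Analysis.FunctionSpaces.TorusAxisAverageCalculus

/-!
# Tools for the leading energy identity of the ε-free hierarchy (line `windfibred`, rev 3)
# (crux stmt-AnomalousDissipation-16293, `NeutralTaylorWaves.TaylorWaveQuasiSteady`)

Calculus on the two-scale torus `T⁴ = T³ × T¹` used by `Theorems/…HierarchyEnergy.lean` (the identity
`∫_{T⁴} |k|²‖∂_θP_0‖² = ∫_{T⁴} ⟪f ∘ slow, P_0⟫` for formal solutions of order `≥ 1`):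

* `partialDeriv_apply_coord'` — coordinates commute with partial derivatives for fields `T^d → ℝ^ι` (the tree's
  `Torus.partialDeriv_apply_coord` has `ι = d`);
* `partialDeriv_last_comp_slow` — functions of the slow point only have no fast derivative, `∂_θ (g ∘ slow) = 0`;
* (smoothness of `sDeriv`/`fDeriv` of smooth profiles is `FormalExpansion.isSmooth_sDeriv/_fDeriv`, landed with
  `stub_formalExpansionW`, p164827, and is only re-exported in the tools conjunction);
* `integral_partialDeriv_mul_eq_neg` — `∫ (∂ₘ a) b = −∫ a ∂ₘ b` for smooth scalars on `T⁴`;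
* `integral_mul_inner_partialDeriv_eq` — `∫ g ⟪∂ₘ U, V⟫ = −∫ g ⟪U, ∂ₘ V⟫ − ∫ (∂ₘ g) ⟪U, V⟫` (weighted integration by
  parts of an inner product, any coordinate `m : Fin 4`), from `Torus.integral_partialDeriv_eq_zero_holds` and the
  Leibniz rules `Torus.partialDeriv_mul`, `Torus.partialDeriv_inner`.

Registered as the tools sub-stub `stub_hierarchyWEnergyTools` (last theorem). [folklore]
-/

-- `Summit.<Summit>.<Problem>` is the tree's mandated summit-side namespace (CONVENTIONS §2); for this
-- single-conjunct summit the two coincide, so the duplicate is deliberate.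
set_option linter.dupNamespace false

noncomputable section

open scoped BigOperators InnerProductSpace ContDiff
open MeasureTheory
open Literature.Analysis.FunctionSpaces Literature.Analysis.FunctionSpaces.Torus

namespace Summit.AnomalousDissipation.AnomalousDissipation.Theorems.TaylorWaveQuasiSteady.Energy

open Summit.AnomalousDissipation.AnomalousDissipation.Theorems.TaylorWaveQuasiSteady

/-! ## §1 Coordinates, slow functions, smoothness -/

section Coord

variable {d : Type*} [Fintype d] [DecidableEq d] {ι : Type*} [Fintype ι]

omit [DecidableEq d] in
/-- Coordinates commute with the torus derivative for fields `T^d → ℝ^ι`: `D(u_l)(x) w = (Du(x) w)_l`. [folklore] -/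
theorem fderiv_apply_coord' {u : UnitAddTorus d → EuclideanSpace ℝ ι} (hu : IsContDiff 1 u)
    (x : UnitAddTorus d) (w : EuclideanSpace ℝ d) (l : ι) :
    Torus.fderiv (fun y => u y l) x w = Torus.fderiv u x w l := by
  have hd : DifferentiableAt ℝ (liftAt u x) 0 :=
    ((hu.liftAt x).differentiable one_ne_zero).differentiableAt
  have h : liftAt (fun y => u y l) x =
      (EuclideanSpace.proj l : EuclideanSpace ℝ ι →L[ℝ] ℝ) ∘ liftAt u x := rfl
  rw [Torus.fderiv, Torus.fderiv, h, ((EuclideanSpace.proj l).hasFDerivAt.comp (0 : EuclideanSpace ℝ d)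
    hd.hasFDerivAt).fderiv]
  rfl

/-- Coordinates commute with partial derivatives for fields `T^d → ℝ^ι`: `∂ₘ(u_l)(x) = (∂ₘ u(x))_l`. [folklore] -/
theorem partialDeriv_apply_coord' {u : UnitAddTorus d → EuclideanSpace ℝ ι} (hu : IsContDiff 1 u)
    (m : d) (x : UnitAddTorus d) (l : ι) :
    partialDeriv m (fun y => u y l) x = partialDeriv m u x l := by
  have hu' : IsContDiff 1 (fun y => u y l) :=
    (EuclideanSpace.proj l : EuclideanSpace ℝ ι →L[ℝ] ℝ).contDiff.comp hu
  rw [partialDeriv_eq_fderiv_apply hu', partialDeriv_eq_fderiv_apply hu, fderiv_apply_coord' hu]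

end Coord

variable {F : Type*} [NormedAddCommGroup F] [NormedSpace ℝ F]

/-- Moving along the fast axis does not change the slow point. [folklore] -/
theorem slow_add_single_last (y : UnitAddTorus (Fin 4)) (s : UnitAddCircle) :
    slow (y + Pi.single (Fin.last 3) s) = slow y := by
  funext i
  show (y + Pi.single (Fin.last 3) s : UnitAddTorus (Fin 4)) i.castSucc = y i.castSucc
  rw [Pi.add_apply, Pi.single_apply, if_neg (Fin.castSucc_lt_last i).ne, add_zero]

/-- **Functions of the slow point have no fast derivative**: `∂_θ (g ∘ slow) = 0`. [folklore] -/
theorem partialDeriv_last_comp_slow (g : UnitAddTorus (Fin 3) → F) (y : UnitAddTorus (Fin 4)) :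
    partialDeriv (Fin.last 3) (fun z : UnitAddTorus (Fin 4) => g (slow z)) y = 0 := by
  have h : (fun t : ℝ => g (slow (y + Torus.proj (t • EuclideanSpace.single (Fin.last 3) (1 : ℝ))))) =
      fun _ => g (slow y) := by
    funext t
    rw [proj_smul_single, slow_add_single_last]
  simp only [Torus.partialDeriv, Torus.lineDeriv]
  rw [h, deriv_const]

/-- Products of smooth real functions are smooth (the `F = ℝ` case of `IsSmooth.smul'`). [folklore] -/
theorem isSmooth_mul {d : Type*} [Fintype d] {a b : UnitAddTorus d → ℝ} (ha : IsSmooth a) (hb : IsSmooth b) :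
    IsSmooth (fun y => a y * b y) :=
  ha.smul' hb

/-! ## §2 Integration by parts on `T⁴` -/

/-- **`∫ (∂ₘ a) b = −∫ a ∂ₘ b`** for smooth real functions on `T⁴` (no boundary). [folklore] -/
theorem integral_partialDeriv_mul_eq_neg {a b : UnitAddTorus (Fin 4) → ℝ} (ha : IsSmooth a) (hb : IsSmooth b)
    (m : Fin 4) :
    ∫ y, partialDeriv m a y * b y = -∫ y, a y * partialDeriv m b y := by
  have ha1 : IsContDiff 1 a := ha.isContDiff (by simp)
  have hb1 : IsContDiff 1 b := hb.isContDiff (by simp)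
  have hab : IsSmooth (fun y => a y * b y) := isSmooth_mul ha hb
  have h0 : ∫ y, partialDeriv m (fun y => a y * b y) y = 0 := integral_partialDeriv_eq_zero_holds hab m
  have hpt : ∀ y, partialDeriv m (fun y => a y * b y) y = a y * partialDeriv m b y + partialDeriv m a y * b y :=
    fun y => partialDeriv_mul ha1 hb1 m y
  simp_rw [hpt] at h0
  have i1 : Integrable (fun y => a y * partialDeriv m b y) := (isSmooth_mul ha (hb.partialDeriv m)).integrable
  have i2 : Integrable (fun y => partialDeriv m a y * b y) := (isSmooth_mul (ha.partialDeriv m) hb).integrable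
  have e : ∫ y, (a y * partialDeriv m b y + partialDeriv m a y * b y) =
      (∫ y, a y * partialDeriv m b y) + ∫ y, partialDeriv m a y * b y := integral_add i1 i2
  rw [e] at h0
  linarith

/-- **Weighted integration by parts of an inner product on `T⁴`**:
`∫ g ⟪∂ₘ U, V⟫ = −∫ g ⟪U, ∂ₘ V⟫ − ∫ (∂ₘ g) ⟪U, V⟫` for smooth `g`, `U`, `V`. [folklore] -/
theorem integral_mul_inner_partialDeriv_eq {E : Type*} [NormedAddCommGroup E] [InnerProductSpace ℝ E]
    {g : UnitAddTorus (Fin 4) → ℝ} {U V : UnitAddTorus (Fin 4) → E}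
    (hg : IsSmooth g) (hU : IsSmooth U) (hV : IsSmooth V) (m : Fin 4) :
    ∫ y, g y * ⟪partialDeriv m U y, V y⟫_ℝ =
      -(∫ y, g y * ⟪U y, partialDeriv m V y⟫_ℝ) - ∫ y, partialDeriv m g y * ⟪U y, V y⟫_ℝ := by
  have hg1 : IsContDiff 1 g := hg.isContDiff (by simp)
  have hU1 : IsContDiff 1 U := hU.isContDiff (by simp)
  have hV1 : IsContDiff 1 V := hV.isContDiff (by simp)
  have hUV : IsSmooth (fun y => ⟪U y, V y⟫_ℝ) := hU.inner hV
  have hUV1 : IsContDiff 1 (fun y => ⟪U y, V y⟫_ℝ) := hUV.isContDiff (by simp)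
  have hφ : IsSmooth (fun y => g y * ⟪U y, V y⟫_ℝ) := isSmooth_mul hg hUV
  have h0 : ∫ y, partialDeriv m (fun y => g y * ⟪U y, V y⟫_ℝ) y = 0 := integral_partialDeriv_eq_zero_holds hφ m
  have hpt : ∀ y, partialDeriv m (fun y => g y * ⟪U y, V y⟫_ℝ) y =
      g y * ⟪U y, partialDeriv m V y⟫_ℝ + g y * ⟪partialDeriv m U y, V y⟫_ℝ
        + partialDeriv m g y * ⟪U y, V y⟫_ℝ := by
    intro y
    rw [partialDeriv_mul hg1 hUV1 m y, partialDeriv_inner hU1 hV1 m y, mul_add]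
  simp_rw [hpt] at h0
  have i1 : Integrable (fun y => g y * ⟪U y, partialDeriv m V y⟫_ℝ) :=
    (isSmooth_mul hg (hU.inner (hV.partialDeriv m))).integrable
  have i2 : Integrable (fun y => g y * ⟪partialDeriv m U y, V y⟫_ℝ) :=
    (isSmooth_mul hg ((hU.partialDeriv m).inner hV)).integrable
  have i3 : Integrable (fun y => partialDeriv m g y * ⟪U y, V y⟫_ℝ) :=
    (isSmooth_mul (hg.partialDeriv m) hUV).integrable
  have e1 : ∫ y, (g y * ⟪U y, partialDeriv m V y⟫_ℝ + g y * ⟪partialDeriv m U y, V y⟫_ℝ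
      + partialDeriv m g y * ⟪U y, V y⟫_ℝ) =
      (∫ y, (g y * ⟪U y, partialDeriv m V y⟫_ℝ + g y * ⟪partialDeriv m U y, V y⟫_ℝ))
        + ∫ y, partialDeriv m g y * ⟪U y, V y⟫_ℝ := integral_add (i1.add i2) i3
  have e2 : ∫ y, (g y * ⟪U y, partialDeriv m V y⟫_ℝ + g y * ⟪partialDeriv m U y, V y⟫_ℝ) =
      (∫ y, g y * ⟪U y, partialDeriv m V y⟫_ℝ) + ∫ y, g y * ⟪partialDeriv m U y, V y⟫_ℝ := integral_add i1 i2
  rw [e1, e2] at h0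
  linarith

/-! ## §3 The registered tools sub-stub -/

/-- **stub_hierarchyWEnergyTools** (registered tools sub-stub of stmt-AnomalousDissipation-16293; conjunction of the
lemmas of this file). [folklore] -/
theorem stub_hierarchyWEnergyTools : (∀ {ι : Type} [Fintype ι] {u : UnitAddTorus (Fin 4) → EuclideanSpace ℝ ι}, Literature.Analysis.FunctionSpaces.Torus.IsContDiff 1 u → ∀ (m : Fin 4) (x : UnitAddTorus (Fin 4)) (l : ι), Literature.Analysis.FunctionSpaces.Torus.partialDeriv m (fun y => u y l) x = Literature.Analysis.FunctionSpaces.Torus.partialDeriv m u x l) ∧ (∀ (g : UnitAddTorus (Fin 3) → ℝ) (y : UnitAddTorus (Fin 4)), Literature.Analysis.FunctionSpaces.Torus.partialDeriv (Fin.last 3) (fun z : UnitAddTorus (Fin 4) => g (slow z)) y = 0) ∧ (∀ (j : Fin 3 → ℤ) {G : UnitAddTorus (Fin 3) → ℝ}, Literature.Analysis.FunctionSpaces.Torus.IsSmooth G → ∀ (i : Fin 3) {Φ : UnitAddTorus (Fin 4) → EuclideanSpace ℝ (Fin 3)}, Literature.Analysis.FunctionSpaces.Torus.IsSmooth Φ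 → Literature.Analysis.FunctionSpaces.Torus.IsSmooth (fDeriv j G i Φ)) ∧ (∀ {a b : UnitAddTorus (Fin 4) → ℝ}, Literature.Analysis.FunctionSpaces.Torus.IsSmooth a → Literature.Analysis.FunctionSpaces.Torus.IsSmooth b → ∀ m : Fin 4, ∫ y, Literature.Analysis.FunctionSpaces.Torus.partialDeriv m a y * b y = -∫ y, a y * Literature.Analysis.FunctionSpaces.Torus.partialDeriv m b y) ∧ (∀ {g : UnitAddTorus (Fin 4) → ℝ} {U V : UnitAddTorus (Fin 4) → EuclideanSpace ℝ (Fin 3)}, Literature.Analysis.FunctionSpaces.Torus.IsSmooth g → Literature.Analysis.FunctionSpaces.Torus.IsSmooth U → Literature.Analysis.FunctionSpaces.Torus.IsSmooth V → ∀ m : Fin 4, ∫ y, g y * inner ℝ (Literature.Analysis.FunctionSpaces.Torus.partialDeriv m U y) (V y) = -(∫ y, g y * inner ℝ (U y) (Literature.Analysis.FunctionSpaces.Torus.partialDeriv m V y)) - ∫ y, Literature.Analysis.FunctionSpaces.Torus.partialDeriv m g y * inner ℝ (U y) (V y)) :=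
  ⟨fun hu m x l => partialDeriv_apply_coord' hu m x l, fun g y => partialDeriv_last_comp_slow g y,
    fun j _ hG i _ hΦ => FormalExpansion.isSmooth_fDeriv j hG i hΦ,
    fun ha hb m => integral_partialDeriv_mul_eq_neg ha hb m,
    fun hg hU hV m => integral_mul_inner_partialDeriv_eq hg hU hV m⟩

end Summit.AnomalousDissipation.AnomalousDissipation.Theorems.TaylorWaveQuasiSteady.Energy

end
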